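import Literature.NumberTheory.LFunctions.HybridJointUniversalityTorus
import Literature.NumberTheory.LFunctions.JointEulerProductDenseness
import Literature.NumberTheory.LFunctions.ZetaUniversalityDiscProofs
import Literature.NumberTheory.DiophantineApproximation.KroneckerWeylArcs
import Mathlib.NumberTheory.LSeries.DirichletContinuation
import HarnessLib

/-!
# Hybrid joint universality — good shifts, complex centres, Cauchy transfers

Tools for the disc form of the hybrid joint universality theorem for Dirichlet `L`-functions
[cite: Pankowski2010, Theorem 1.1], assembled in `HybridJointUniversalityProofs.lean`:

* `exists_joint_eulerProduct_near_complex` — the joint denseness of twisted finite Euler products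
  (`JointEulerProductDenseness.lean`) transported from a real centre to a disc with complex centre
  `c` by the vertical shift `s ↦ s + i Im c` [cite: Pankowski2010, Remark 2.1, (8)];
* `exists_int_of_dist_coe_lt` — distances on `ℝ/ℤ` versus integer approximations (the Kronecker
  half of the theorem);
* holomorphy of `L(z + it, χ) − ∏_{p<P}(1 − χ(p)p^{−z−it})⁻¹` on closed discs inside the strip
  `1/2 < Re z < 1`, the Cauchy (Bergman) transfer from the circle `|s − c| = ρ'` to the disc
  `|s − c| ≤ ρ` [cite: Pankowski2010, Lemma 3.1, proof], and continuity of the circle data in `t`;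
* `norm_LFunction_sub_lt_of_good` — the deterministic end of the argument: at a shift `t` where the
  circle mean squares of `L − ∏_{p<P}` and of the tail logarithm are small and the steering product
  is `ε/4`-close to `f`, one gets `|L(s + it, χ) − f(s)| < ε` on the disc
  [cite: Pankowski2010, §4, (14)–(16)].

All statements are proved; no new named facts.
-/

noncomputable section

open Complex Filter Set Metric MeasureTheory
open scoped Real

namespace Literature.NumberTheory.LFunctions

namespace HybridShifts

open Literature.NumberTheory.DiophantineApproximation
open Literature.Barriers.RiemannHypothesis.BohrCourant (rpow_neg_le_half)
open VoroninTools VoroninTorus VoroninAssembly HybridTorus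

/-! ### Joint denseness at a complex centre -/

/-- `p^{it₀} · e(ϑ) = e(ϑ + t₀ log p/2π)`: the vertical shift of the twist. [folklore] -/
theorem cpow_mul_I_mul_cexp {p : ℕ} (hp : p ≠ 0) (t₀ ϑ : ℝ) :
    (p : ℂ) ^ ((t₀ : ℂ) * I) * cexp (2 * Real.pi * I * ϑ) =
      cexp (2 * Real.pi * I * ((ϑ + t₀ * Real.log p / (2 * Real.pi) : ℝ) : ℂ)) := by
  have hp' : (p : ℂ) ≠ 0 := by exact_mod_cast hp
  have hπ : (Real.pi : ℂ) ≠ 0 := by exact_mod_cast Real.pi_ne_zero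
  rw [Complex.cpow_def_of_ne_zero hp', ← Complex.natCast_log, ← Complex.exp_add]
  congr 1
  push_cast
  field_simp
  ring

/-- **Joint denseness of twisted finite Euler products, complex centre.** The statement of
`JointDenseness.exists_joint_eulerProduct_near` for a disc `|s − c| ≤ r` with complex centre `c`
(`1/2 < Re c − r`, `Re c + r < 1`), by the vertical shift `s ↦ s + i Im c`, `ϑ_p ↦ ϑ_p + Im c · log p/2π`.
[cite: Pankowski2010, Remark 2.1 and Lemma 3.1 (proof, (8))] -/
theorem exists_joint_eulerProduct_near_complex {ι : Type} [Fintype ι] {q : ι → ℕ}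
    [∀ i, NeZero (q i)] (χ : ∀ i, DirichletCharacter ℂ (q i))
    (hχ : Pairwise fun i j ↦
      (⟨(χ i).conductor, (χ i).primitiveCharacter⟩ : Σ n, DirichletCharacter ℂ n) ≠
        ⟨(χ j).conductor, (χ j).primitiveCharacter⟩)
    (c : ℂ) (r R : ℝ) (hr : 0 < r) (hrR : r < R) (h1 : 1 / 2 < c.re - r) (h2 : c.re + r < 1)
    (g : ι → ℂ → ℂ) (hg : ∀ i, DifferentiableOn ℂ (g i) (ball c R))
    (hg0 : ∀ i, ∀ s ∈ ball c R, g i s ≠ 0)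
    (ε : ℝ) (hε : 0 < ε) (y : ℕ) (B₀ : Finset ℕ) :
    ∃ M : Finset ℕ, (∀ p ∈ M, p.Prime) ∧ Disjoint M B₀ ∧
      (∀ p : ℕ, p.Prime → p ≤ y → p ∉ B₀ → p ∈ M) ∧
      ∃ ϑ : ℕ → ℝ, ∀ i, ∀ s ∈ closedBall c r,
        ‖g i s - ∏ p ∈ M, (1 - χ i p * (p : ℂ) ^ (-s) * cexp (2 * Real.pi * I * ϑ p))⁻¹‖ < ε := by
  set t₀ : ℝ := c.im with ht₀
  -- the shifted targets on the disc with real centre `Re c`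
  set gs : ι → ℂ → ℂ := fun i s ↦ g i (s + t₀ * I) with hgs
  have hshift : ∀ {ρ₀ : ℝ} {s : ℂ}, dist s (c.re : ℂ) = dist (s + t₀ * I) c := by
    intro ρ₀ s
    rw [dist_eq_norm, dist_eq_norm]
    congr 1
    conv_rhs => rw [← re_add_im c]
    ring
  have hmaps : MapsTo (fun s : ℂ ↦ s + t₀ * I) (ball (c.re : ℂ) R) (ball c R) := by
    intro s hs
    rw [mem_ball] at hs ⊢
    rwa [← hshift (ρ₀ := R)]
  have hgsd : ∀ i, DifferentiableOn ℂ (gs i) (ball (c.re : ℂ) R) := fun i ↦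
    (hg i).comp ((differentiable_id.add_const _).differentiableOn) hmaps
  have hgs0 : ∀ i, ∀ s ∈ ball (c.re : ℂ) R, gs i s ≠ 0 := fun i s hs ↦ hg0 i _ (hmaps hs)
  have h1' : 1 / 2 < (c.re : ℂ).re - r := by simpa using h1
  have h2' : (c.re : ℂ).re + r < 1 := by simpa using h2
  obtain ⟨M, hMp, hMB, hMy, ϑ, happ⟩ := JointDenseness.exists_joint_eulerProduct_near χ hχ c.re r R
    hr hrR (by simpa using h1) (by simpa using h2) gs hgsd hgs0 ε hε y B₀
  refine ⟨M, hMp, hMB, hMy, fun p ↦ ϑ p + t₀ * Real.log p / (2 * Real.pi), fun i s hs ↦ ?_⟩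
  -- `s = s̃ + i t₀` with `s̃` in the real-centred disc
  set s' : ℂ := s - t₀ * I with hs'
  have hs'mem : s' ∈ closedBall (c.re : ℂ) r := by
    rw [mem_closedBall, hshift (ρ₀ := r), hs', sub_add_cancel]
    exact hs
  have h := happ i s' hs'mem
  have e1 : gs i s' = g i s := by simp [hgs, hs']
  have e2 : ∀ p ∈ M, (1 - χ i p * (p : ℂ) ^ (-s') * cexp (2 * Real.pi * I * ϑ p))⁻¹ =
      (1 - χ i p * (p : ℂ) ^ (-s) *
        cexp (2 * Real.pi * I * ((ϑ p + t₀ * Real.log p / (2 * Real.pi) : ℝ) : ℂ)))⁻¹ := by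
    intro p hp
    have hp0 : p ≠ 0 := (hMp p hp).ne_zero
    have hp0' : (p : ℂ) ≠ 0 := by exact_mod_cast hp0
    have hps : (p : ℂ) ^ (-s') = (p : ℂ) ^ (-s) * (p : ℂ) ^ ((t₀ : ℂ) * I) := by
      rw [← Complex.cpow_add _ _ hp0']
      congr 1
      rw [hs']; ring
    congr 2
    rw [hps, ← cpow_mul_I_mul_cexp hp0]
    ring
  rw [e1, Finset.prod_congr rfl e2] at h
  exact h

/-! ### Distances on the circle and integer approximations -/

/-- `dist (x mod 1) (y mod 1) < r` means `|x − y − m| < r` for some integer `m`. [folklore] -/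
theorem exists_int_of_dist_coe_lt {x y r : ℝ}
    (h : dist ((x : ℝ) : UnitAddCircle) ((y : ℝ) : UnitAddCircle) < r) : ∃ m : ℤ, |x - y - m| < r := by
  rw [dist_eq_norm, ← AddCircle.coe_sub] at h
  exact (KroneckerWeyl.norm_coe_lt_iff_exists_int (x - y) r).1 h

/-! ### `L(s, χ) − ∏_{p<P}` on discs in the strip -/

section LFunction

variable {q : ℕ} [NeZero q] (χ : DirichletCharacter ℂ q)

/-- `L(z, χ) − ∏_{p<P}(1 − χ(p) p^{−z})⁻¹` is holomorphic on the open strip `1/2 < Re z < 1`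
(any `χ`; the only possible pole is `z = 1`). [folklore] -/
theorem differentiableOn_LFunction_sub_eulerProduct_strip (P : ℕ) :
    DifferentiableOn ℂ (fun z ↦ χ.LFunction z -
      ∏ p ∈ P.primesBelow, (1 - χ p * (p : ℂ) ^ (-z))⁻¹) {z : ℂ | 1 / 2 < z.re ∧ z.re < 1} := by
  intro z hz
  have hne : z ≠ 1 := by intro h; rw [h] at hz; norm_num at hz
  refine DifferentiableAt.differentiableWithinAt (DifferentiableAt.sub ?_ ?_)
  · exact DirichletCharacter.differentiableAt_LFunction χ z (Or.inl hne)
  · refine DifferentiableAt.fun_finsetProd fun p hp ↦ DifferentiableAt.inv ?_ ?_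
    · have hp0 : (p : ℂ) ≠ 0 := by exact_mod_cast (Nat.prime_of_mem_primesBelow hp).ne_zero
      exact (differentiableAt_const _).sub
        ((differentiableAt_id.neg.const_cpow (Or.inl hp0)).const_mul _)
    · intro h
      have hpr := Nat.prime_of_mem_primesBelow hp
      have hn : ‖χ p * (p : ℂ) ^ (-z)‖ < 1 := by
        have h1 := norm_datum_le (a := fun n ↦ χ n) (fun n ↦ χ.norm_le_one _) hpr.ne_zero z norm_one
        rw [mul_one] at h1
        exact h1.trans_lt (Real.rpow_lt_one_of_one_lt_of_neg (by exact_mod_cast hpr.one_lt)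
          (by linarith [hz.1]))
      rw [sub_eq_zero] at h
      rw [← h, norm_one] at hn
      exact lt_irrefl _ hn

/-- The same function of `z + it` is holomorphic on every closed disc in the strip. [folklore] -/
theorem differentiableOn_LFunction_sub_eulerProduct {c : ℂ} {ρ' : ℝ} (h1 : 1 / 2 < c.re - ρ')
    (h2 : c.re + ρ' < 1) (P : ℕ) (t : ℝ) :
    DifferentiableOn ℂ (fun z ↦ χ.LFunction (z + t * I) -
      ∏ p ∈ P.primesBelow, (1 - χ p * (p : ℂ) ^ (-(z + t * I)))⁻¹) (closedBall c ρ') := by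
  have hmaps : MapsTo (fun z : ℂ ↦ z + t * I) (closedBall c ρ') {z : ℂ | 1 / 2 < z.re ∧ z.re < 1} := by
    intro z hz
    obtain ⟨ha, hb⟩ := abs_le.1 (abs_re_sub_re_le_of_mem_closedBall hz)
    simp only [mem_setOf_eq, add_re, mul_I_re, ofReal_im, neg_zero, add_zero]
    exact ⟨by linarith, by linarith⟩
  exact (differentiableOn_LFunction_sub_eulerProduct_strip χ P).comp
    ((differentiable_id.add_const _).differentiableOn) hmaps

/-- **Cauchy transfer**: the supremum of `|L(s+it, χ) − ∏_{p<P}(…)⁻¹|²` over `|s − c| ≤ ρ` is at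
most `ρ'²/(2π(ρ'−ρ)²)` times its integral over the circle `|s − c| = ρ'` (`ρ < ρ'`, the closed disc
of radius `ρ'` inside the strip). [cite: Pankowski2010, Lemma 3.1 (proof: Theorem A.2.7 of [KV])] -/
theorem norm_sq_LFunction_sub_eulerProduct_le {c : ℂ} {ρ ρ' : ℝ} (hρ : 0 ≤ ρ) (hρρ' : ρ < ρ')
    (h1 : 1 / 2 < c.re - ρ') (h2 : c.re + ρ' < 1) (P : ℕ) (t : ℝ) {s : ℂ}
    (hs : s ∈ closedBall c ρ) :
    ‖χ.LFunction (s + t * I) - ∏ p ∈ P.primesBelow, (1 - χ p * (p : ℂ) ^ (-(s + t * I)))⁻¹‖ ^ 2 ≤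
      ρ' ^ 2 / (2 * π * (ρ' - ρ) ^ 2) * ∫ α in (0 : ℝ)..2 * π,
        ‖χ.LFunction (circleMap c ρ' α + t * I) -
          ∏ p ∈ P.primesBelow, (1 - χ p * (p : ℂ) ^ (-(circleMap c ρ' α + t * I)))⁻¹‖ ^ 2 := by
  have hd := (differentiableOn_LFunction_sub_eulerProduct χ h1 h2 P t).mono
    (closure_ball_subset_closedBall : closure (ball c ρ') ⊆ closedBall c ρ')
  exact norm_sq_le_mul_integral_norm_sq_circle hρ hρρ' hd.diffContOnCl hs

/-- The circle integrand is jointly continuous in the shift `t` and the circle parameter `α`.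
[folklore] -/
theorem continuous_LFunction_sub_eulerProduct_circle {c : ℂ} {ρ' : ℝ} (hρ' : 0 ≤ ρ')
    (h1 : 1 / 2 < c.re - ρ') (h2 : c.re + ρ' < 1) (P : ℕ) :
    Continuous (Function.uncurry fun (t α : ℝ) ↦ ‖χ.LFunction (circleMap c ρ' α + t * I) -
      ∏ p ∈ P.primesBelow, (1 - χ p * (p : ℂ) ^ (-(circleMap c ρ' α + t * I)))⁻¹‖ ^ 2) := by
  have hcont := (differentiableOn_LFunction_sub_eulerProduct_strip χ P).continuousOn
  have hmap : Continuous fun p : ℝ × ℝ ↦ circleMap c ρ' p.2 + p.1 * I :=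
    ((continuous_circleMap c ρ').comp continuous_snd).add
      ((Complex.continuous_ofReal.comp continuous_fst).mul continuous_const)
  have hin : ∀ p : ℝ × ℝ, circleMap c ρ' p.2 + p.1 * I ∈ {z : ℂ | 1 / 2 < z.re ∧ z.re < 1} := by
    intro p
    have hz : circleMap c ρ' p.2 ∈ closedBall c ρ' :=
      sphere_subset_closedBall (circleMap_mem_sphere c hρ' p.2)
    obtain ⟨ha, hb⟩ := abs_le.1 (abs_re_sub_re_le_of_mem_closedBall hz)
    simp only [mem_setOf_eq, add_re, mul_I_re, ofReal_im, neg_zero, add_zero]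
    exact ⟨by linarith, by linarith⟩
  have h := hcont.comp_continuous hmap hin
  exact (continuous_norm.comp h).pow 2

end LFunction

/-! ### The tail sum: Cauchy transfer -/

/-- The tail sum `s ↦ L(s, θ)` is entire, so its supremum on `|s − c| ≤ ρ` is controlled by its mean
square on the circle `|s − c| = ρ'`. [folklore] -/
theorem norm_sq_Lt_le {κ : Type} (J : Finset κ) (P : ℕ) (St : Finset ℕ) (a : ℕ → ℂ) {c : ℂ}
    {ρ ρ' : ℝ} (hρ : 0 ≤ ρ) (hρρ' : ρ < ρ') (θ : UnitAddTorus (↥J ⊕ ↥(P.primesBelow))) {s : ℂ}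
    (hs : s ∈ closedBall c ρ) :
    ‖Lt J P St a s θ‖ ^ 2 ≤ ρ' ^ 2 / (2 * π * (ρ' - ρ) ^ 2) *
      ∫ α in (0 : ℝ)..2 * π, ‖Lt J P St a (circleMap c ρ' α) θ‖ ^ 2 := by
  have hd : Differentiable ℂ fun z : ℂ ↦ Lt J P St a z θ := by
    unfold Lt
    refine Differentiable.fun_sum fun q' _ ↦ ?_
    have hq : ((q' : ℕ) : ℂ) ≠ 0 := by exact_mod_cast (Nat.prime_of_mem_primesBelow q'.2).ne_zero
    exact ((differentiable_id.neg.const_cpow (Or.inl hq)).const_mul _).mul_const _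
  exact norm_sq_le_mul_integral_norm_sq_circle hρ hρρ' hd.diffContOnCl hs

/-! ### The pointwise conclusion at a good shift -/

/-- **The three-epsilon step at a good shift, `χ`-twisted.** On the hybrid torus let `Z(s,θ)` be
the steering product, `Q(s,θ)` the tail product and `L(s,θ)` the tail sum (all tail primes `≥ 4`,
`|a| ≤ 1`, `a(n) = χ(n)`). If at the torus point `θ` and the shift `t`: `Z(s,θ)` is within `ε/4` of
`f(s)` and `|f| ≤ M` on the disc, `|L(s,θ)| < δ₁`, `Σ q^{-2 Re s} ≤ δ₁ ≤ 1/32`,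
`(M+1)·4δ₁ ≤ ε/4`, `L(s+it, χ)` is within `ε/4` of the full product `∏_{p<P} = Z(s,θ)Q(s,θ)`,
then `|L(s+it, χ) − f(s)| < ε` on the disc. [cite: Pankowski2010, Lemma 3.1 and Thm. 4.2 (proofs)] -/
theorem norm_LFunction_sub_lt_of_good {κ : Type} (J : Finset κ) {P : ℕ} (St : Finset ℕ)
    (h4 : ∀ q' ∈ Tl P St, 4 ≤ (q' : ℕ)) {q : ℕ} [NeZero q] (χ : DirichletCharacter ℂ q)
    {c : ℂ} {ρ : ℝ} (hσ : 1 / 2 < c.re - ρ)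
    (θ : UnitAddTorus (↥J ⊕ ↥(P.primesBelow))) (t : ℝ) {f : ℂ → ℂ} {Z : ℂ → ℂ} {M δ₁ ε : ℝ}
    (hε1 : ε ≤ 1) (hδ₁ : δ₁ ≤ 1 / 32) (hKδ : (M + 1) * (4 * δ₁) ≤ ε / 4)
    (hM : ∀ s ∈ closedBall c ρ, ‖f s‖ ≤ M)
    (hZg : ∀ s ∈ closedBall c ρ, ‖Z s - f s‖ < ε / 4)
    (hL : ∀ s ∈ closedBall c ρ, ‖Lt J P St (fun n ↦ χ n) s θ‖ < δ₁)
    (htail : ∀ s ∈ closedBall c ρ, ∑ q' ∈ Tl P St, (((q' : ℕ) : ℝ) ^ (-s.re)) ^ 2 ≤ δ₁)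
    (hZP : ∀ s : ℂ, ∏ p ∈ P.primesBelow, (1 - χ p * (p : ℂ) ^ (-(s + t * I)))⁻¹ =
      Z s * Qtl J P St (fun n ↦ χ n) s θ)
    (hEz : ∀ s ∈ closedBall c ρ, ‖χ.LFunction (s + t * I) -
      ∏ p ∈ P.primesBelow, (1 - χ p * (p : ℂ) ^ (-(s + t * I)))⁻¹‖ < ε / 4) :
    ∀ s ∈ closedBall c ρ, ‖χ.LFunction (s + t * I) - f s‖ < ε := by
  intro s hs
  have hsre : 1 / 2 < s.re := by
    have := (abs_le.1 (abs_re_sub_re_le_of_mem_closedBall hs)).1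
    linarith
  set Q : ℂ := Qtl J P St (fun n ↦ χ n) s θ with hQ
  have hQ1 : ‖Q - 1‖ ≤ 4 * δ₁ := by
    have hsmall : ‖Lt J P St (fun n ↦ χ n) s θ‖ +
        ∑ q' ∈ Tl P St, (((q' : ℕ) : ℝ) ^ (-s.re)) ^ 2 ≤ 1 := by
      linarith [hL s hs, htail s hs]
    have h := norm_Qtl_sub_one_le J P h4 (fun n ↦ χ.norm_le_one _) hsre θ hsmall
    rw [← hQ] at h
    linarith [hL s hs, htail s hs]
  have hZnorm : ‖Z s‖ ≤ M + 1 := by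
    have h1 := norm_le_insert' (Z s) (f s)
    have h2 := hM s hs
    have h3 := hZg s hs
    linarith
  have hδ₁0 : 0 ≤ δ₁ := (norm_nonneg _).trans (hL s hs).le
  have hmid : ‖Z s * Q - Z s‖ ≤ ε / 4 := by
    rw [← mul_sub_one, norm_mul]
    calc ‖Z s‖ * ‖Q - 1‖ ≤ (M + 1) * (4 * δ₁) :=
          mul_le_mul hZnorm hQ1 (norm_nonneg _) (by linarith [norm_nonneg (f s), hM s hs])
      _ ≤ ε / 4 := hKδ
  have hEz' : ‖χ.LFunction (s + t * I) - Z s * Q‖ < ε / 4 := by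
    have := hEz s hs
    rwa [hZP s] at this
  calc ‖χ.LFunction (s + t * I) - f s‖
      = ‖(χ.LFunction (s + t * I) - Z s * Q) + (Z s * Q - Z s) + (Z s - f s)‖ := by ring_nf
    _ ≤ ‖χ.LFunction (s + t * I) - Z s * Q‖ + ‖Z s * Q - Z s‖ + ‖Z s - f s‖ := norm_add₃_le
    _ < ε / 4 + ε / 4 + ε / 4 := by linarith [hZg s hs]
    _ < ε := by
        have hε0 : 0 < ε := by linarith [norm_nonneg (Z s - f s), hZg s hs]
        linarith

end HybridShifts

end Literature.NumberTheory.LFunctions
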